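/- EXTRA WIDTH seat `ym-line-cbag-p1-w4` (g8), LINE 7 `GlueballBandRecursion`, in support of ⟨stmt-QuantumFields-22957⟩
`OneParticleBlochSymbolFamily` (= `Band.EffectiveBlochSymbolFamily`): the finite-dimensional linear algebra of the planner's stub S2
`stub_blochSymbolOfCovariantFamily` (STUB-PLAN 2026-08-28T18:17Z) — block-circulant (Bloch) reduction on the discrete torus `(ℤ/N)³`.
Route-independent (no `Theses` import); definition-free. -/
import Summits.QuantumFields.YangMills.Theorems.GlueballBandRecursionOneGlueballBandDichotomyBandTopFlat
import Literature.Combinatorics.SimpleGraph.CycleSpectrum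

/-!
# Route `GlueballBandRecursion`: Bloch (block-circulant) reduction on the discrete torus `(ℤ/N)³`

The effective one-particle Bloch symbol family (`Band.EffectiveBlochSymbolFamily`, item ⟨stmt-QuantumFields-22957⟩) controls the cold
thermal trace of the strong-coupling transfer matrix by `Σ_p Re tr B̃_N(θ_p)^t`, the sum over torus momenta `p ∈ (Fin N)³` of traces of
powers of an `n × n` matrix symbol at the lattice angles `θ_p = latticeAngle N p`.  The algebra behind that expression is the
block-diagonalisation of a translation-invariant ("block-circulant") matrix on `(ℤ/N)³ × Fin n` by torus momenta.  This file proves it,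
DEFINITION-FREE (the torus characters `χ`, the symbol `B` and the Bloch-wave matrix `F` are bound by their defining equations as
hypotheses, so any later typing of the stub can instantiate them):

* §1 torus characters `χ_p(x) = exp(i Σ_i θ_p,i · x_i) = Π_i ζ_{p_i}^{x_i}` (`ζ_k = cycleRoot N k = e^{2πik/N}`): closed form
  (`exp_latticeAngle_eq_prod_cycleRoot`), `χ_p(0) = 1`, multiplicativity `χ_p(x + y) = χ_p(x) χ_p(y)`, symmetry `χ_p(x) = χ_x(p)`,
  unimodularity `conj χ_p(x) = χ_p(x)⁻¹`, `χ_p(−x) = conj χ_p(x)`, `χ_p(x − y) = χ_p(x) conj χ_p(y)`, and the orthogonality relations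
  `Σ_p χ_p(x) conj χ_p(y) = N³ δ_{xy}`, `Σ_x χ_p(x) conj χ_q(x) = N³ δ_{pq}` (3D lift of the tree's `star_cycleMode_dotProduct_cycleMode`).
* §2 block-circulant reduction: for `M : Matrix ((Fin N)³ × Fin n) ((Fin N)³ × Fin n) ℂ` with `M (x+a, j) (y+a, k) = M (x, j) (y, k)`
  and symbol `B p j k = Σ_x M (x, j) (0, k) conj χ_p(x)`: Bloch waves are mapped to Bloch waves (`mulVec_blochWave`), the Bloch-wave
  matrix `F (x, j) (k, p) = δ_{jk} χ_p(x)` satisfies `Fᴴ F = N³·1 = F Fᴴ` and intertwines `M F = F · blockDiagonal B`, hence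
  `M = N⁻³ · F (blockDiagonal B) Fᴴ`, `M^t = N⁻³ · F (blockDiagonal (B ·)^t) Fᴴ`, the TRACE FORMULA `tr M^t = Σ_p tr (B p)^t`
  (`trace_pow_eq_sum_trace_symbol_pow`), and `M` Hermitian ⇒ every `B p` Hermitian (`isHermitian_symbol`).

Sources: folklore (discrete Bloch theorem / block-circulant matrices; Golub–Van Loan §4.8.2 for the scalar circulant case, in the tree
as `Literature/LinearAlgebra/Matrix/CirculantDFT.lean`).  Deliberately NOT here: anything about the transfer matrix, the cluster
expansion, or smoothness of a symbol in the momentum (stubs S1, S3, S4 of the plan).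

HONEST FRAMING.  Finite-dimensional linear algebra only.  Neither item 22957, nor the rung `ColdDoublingRecursionStrongCoupling`, nor the
Yang–Mills mass gap is proved or advanced here.
-/

set_option autoImplicit false

noncomputable section

open Finset Matrix Complex
open Literature.Combinatorics.SimpleGraph (cycleAngle cycleRoot cycleMode cycleRoot_eq_pow cycleRoot_pow_card cycleRoot_ne_zero
  star_cycleRoot star_cycleMode_dotProduct_cycleMode)

namespace Summit.QuantumFields.YangMills.Theorems.GlueballBandRecursion.Bloch

open Summit.QuantumFields.YangMills.Theorems.GlueballBandRecursion.Band (coordsF coordsF_add coordsF_sub latticeAngle)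

variable {N : ℕ}

/-! ## §0 One-dimensional kernel: roots of unity -/

/-- `ζ_k^a = ζ_a^k` (`= e^{2πiak/N}`): the Fourier matrix of the ring is symmetric. [folklore] -/
theorem cycleRoot_pow_symm (a k : Fin N) : cycleRoot N k ^ a.val = cycleRoot N a ^ k.val := by
  rw [cycleRoot_eq_pow, cycleRoot_eq_pow, ← pow_mul, ← pow_mul, Nat.mul_comm]

/-- `ζ_k^m` depends only on `m mod N` (`ζ_k^N = 1`). [folklore] -/
theorem cycleRoot_pow_mod (k : Fin N) (m : ℕ) : cycleRoot N k ^ (m % N) = cycleRoot N k ^ m := by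
  conv_rhs => rw [← Nat.mod_add_div m N, pow_add, pow_mul, cycleRoot_pow_card, one_pow, mul_one]

/-- `conj (ζ_k^m) = (ζ_k^m)⁻¹` (roots of unity are unimodular). [folklore] -/
theorem star_cycleRoot_pow (k : Fin N) (m : ℕ) : star (cycleRoot N k ^ m) = (cycleRoot N k ^ m)⁻¹ := by
  rw [star_pow, star_cycleRoot, inv_pow]

/-- **Orthogonality of the roots of unity in the mode index**: `Σ_k ζ_k^a conj(ζ_k^b) = N δ_{ab}`. [folklore] -/
theorem sum_cycleRoot_pow_mul_star (a b : Fin N) :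
    ∑ k : Fin N, cycleRoot N k ^ a.val * star (cycleRoot N k ^ b.val) = if a = b then (N : ℂ) else 0 := by
  have h := star_cycleMode_dotProduct_cycleMode (N := N) b a
  simp only [dotProduct, Pi.star_apply, cycleMode] at h
  calc ∑ k : Fin N, cycleRoot N k ^ a.val * star (cycleRoot N k ^ b.val)
      = ∑ k : Fin N, star (cycleRoot N b ^ k.val) * cycleRoot N a ^ k.val := by
        refine Finset.sum_congr rfl fun k _ => ?_
        rw [cycleRoot_pow_symm a k, cycleRoot_pow_symm b k, mul_comm]
    _ = if b = a then (N : ℂ) else 0 := h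
    _ = if a = b then (N : ℂ) else 0 := by simp only [eq_comm]

/-! ## §1 Torus characters on `(Fin N)³` -/

/-- **Closed form of the torus character**: `exp(i Σ_i θ_p,i x_i) = Π_i ζ_{p_i}^{x_i}` with `θ_p = latticeAngle N p` and
`ζ_k = e^{2πik/N}`. [folklore] -/
theorem exp_latticeAngle_eq_prod_cycleRoot (p x : Fin N × Fin N × Fin N) :
    Complex.exp (((∑ i : Fin 3, latticeAngle N p i * ((coordsF x i).val : ℝ) : ℝ) : ℂ) * Complex.I) =
      ∏ i : Fin 3, cycleRoot N (coordsF p i) ^ (coordsF x i).val := by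
  rw [Complex.ofReal_sum, Finset.sum_mul, Complex.exp_sum]
  refine Finset.prod_congr rfl fun i _ => ?_
  rw [cycleRoot, ← Complex.exp_nat_mul, cycleAngle, latticeAngle]
  congr 1
  push_cast
  ring

section Characters

variable (χ : (Fin N × Fin N × Fin N) → (Fin N × Fin N × Fin N) → ℂ)
  (hχ : ∀ p x, χ p x = Complex.exp (((∑ i : Fin 3, latticeAngle N p i * ((coordsF x i).val : ℝ) : ℝ) : ℂ) * Complex.I))
include hχ

/-- The character as a product of roots of unity. [folklore] -/
theorem char_eq_prod (p x : Fin N × Fin N × Fin N) : χ p x = ∏ i : Fin 3, cycleRoot N (coordsF p i) ^ (coordsF x i).val := by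
  rw [hχ, exp_latticeAngle_eq_prod_cycleRoot]

/-- **Symmetry** `χ_p(x) = χ_x(p)` (both are `exp(2πi p·x/N)`). [folklore] -/
theorem char_symm (p x : Fin N × Fin N × Fin N) : χ p x = χ x p := by
  rw [char_eq_prod χ hχ, char_eq_prod χ hχ]
  exact Finset.prod_congr rfl fun i _ => cycleRoot_pow_symm _ _

/-- `χ_p(x) ≠ 0`. [folklore] -/
theorem char_ne_zero (p x : Fin N × Fin N × Fin N) : χ p x ≠ 0 := by
  rw [char_eq_prod χ hχ]
  exact Finset.prod_ne_zero_iff.2 fun i _ => pow_ne_zero _ (cycleRoot_ne_zero _)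

/-- **Unimodularity** `conj χ_p(x) = χ_p(x)⁻¹`. [folklore] -/
theorem star_char (p x : Fin N × Fin N × Fin N) : star (χ p x) = (χ p x)⁻¹ := by
  rw [char_eq_prod χ hχ, star_prod, ← Finset.prod_inv_distrib]
  exact Finset.prod_congr rfl fun i _ => star_cycleRoot_pow _ _

/-- `χ_p(x) conj χ_p(x) = 1`. [folklore] -/
theorem char_mul_star_self (p x : Fin N × Fin N × Fin N) : χ p x * star (χ p x) = 1 := by
  rw [star_char χ hχ, mul_inv_cancel₀ (char_ne_zero χ hχ p x)]

/-- **Multiplicativity in the position**: `χ_p(x + y) = χ_p(x) χ_p(y)` (uses `ζ^N = 1`). [folklore] -/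
theorem char_add_right (p x y : Fin N × Fin N × Fin N) : χ p (x + y) = χ p x * χ p y := by
  rw [char_eq_prod χ hχ, char_eq_prod χ hχ, char_eq_prod χ hχ, ← Finset.prod_mul_distrib]
  refine Finset.prod_congr rfl fun i _ => ?_
  rw [coordsF_add, Pi.add_apply, Fin.val_add, cycleRoot_pow_mod, pow_add]

/-- Multiplicativity in the momentum: `χ_{p+q}(x) = χ_p(x) χ_q(x)`. [folklore] -/
theorem char_add_left (p q x : Fin N × Fin N × Fin N) : χ (p + q) x = χ p x * χ q x := by
  rw [char_symm χ hχ, char_add_right χ hχ, char_symm χ hχ x p, char_symm χ hχ x q]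

variable [NeZero N]

/-- `χ_p(0) = 1`. [folklore] -/
theorem char_zero_right (p : Fin N × Fin N × Fin N) : χ p 0 = 1 := by
  rw [char_eq_prod χ hχ]
  refine Finset.prod_eq_one fun i _ => ?_
  have : coordsF (0 : Fin N × Fin N × Fin N) i = 0 := by fin_cases i <;> rfl
  rw [this, Fin.val_zero, pow_zero]

/-- `χ_0(x) = 1`. [folklore] -/
theorem char_zero_left (x : Fin N × Fin N × Fin N) : χ 0 x = 1 := by
  rw [char_symm χ hχ, char_zero_right χ hχ]

/-- `χ_p(−x) = conj χ_p(x)`. [folklore] -/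
theorem char_neg_right (p x : Fin N × Fin N × Fin N) : χ p (-x) = star (χ p x) := by
  have h : χ p (-x) * χ p x = 1 := by rw [← char_add_right χ hχ, neg_add_cancel, char_zero_right χ hχ]
  rw [star_char χ hχ]
  exact eq_inv_of_mul_eq_one_left h

/-- `χ_p(x − y) = χ_p(x) conj χ_p(y)`. [folklore] -/
theorem char_sub_right (p x y : Fin N × Fin N × Fin N) : χ p (x - y) = χ p x * star (χ p y) := by
  rw [sub_eq_add_neg, char_add_right χ hχ, char_neg_right χ hχ]

/-- `χ_{−p}(x) = conj χ_p(x)`. [folklore] -/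
theorem char_neg_left (p x : Fin N × Fin N × Fin N) : χ (-p) x = star (χ p x) := by
  rw [char_symm χ hχ, char_neg_right χ hχ, char_symm χ hχ x p]

omit [NeZero N] in
/-- **Orthogonality of the torus characters (sum over momenta)**: `Σ_p χ_p(x) conj χ_p(y) = N³ δ_{xy}`. [folklore] -/
theorem sum_char_mul_star (x y : Fin N × Fin N × Fin N) :
    ∑ p : Fin N × Fin N × Fin N, χ p x * star (χ p y) = if x = y then (N : ℂ) ^ 3 else 0 := by
  have hterm : ∀ p : Fin N × Fin N × Fin N, χ p x * star (χ p y) =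
      (cycleRoot N p.1 ^ x.1.val * star (cycleRoot N p.1 ^ y.1.val)) *
        ((cycleRoot N p.2.1 ^ x.2.1.val * star (cycleRoot N p.2.1 ^ y.2.1.val)) *
          (cycleRoot N p.2.2 ^ x.2.2.val * star (cycleRoot N p.2.2 ^ y.2.2.val))) := by
    intro p
    rw [char_eq_prod χ hχ, char_eq_prod χ hχ, star_prod, Fin.prod_univ_three, Fin.prod_univ_three]
    simp only [coordsF, Matrix.cons_val_zero, Matrix.cons_val_one, Matrix.cons_val_two, Matrix.head_cons, Matrix.tail_cons]
    ring
  simp_rw [hterm]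
  rw [Fintype.sum_prod_type]
  dsimp only
  rw [← Finset.sum_mul_sum, Fintype.sum_prod_type]
  dsimp only
  rw [← Finset.sum_mul_sum, sum_cycleRoot_pow_mul_star, sum_cycleRoot_pow_mul_star, sum_cycleRoot_pow_mul_star]
  by_cases h : x = y
  · subst h
    simp only [if_true]
    ring
  · rw [if_neg h]
    obtain ⟨x1, x2, x3⟩ := x
    obtain ⟨y1, y2, y3⟩ := y
    simp only [Prod.mk.injEq, not_and_or] at h
    rcases h with h | h | h <;> simp [h]

omit [NeZero N] in
/-- **Orthogonality of the torus characters (sum over positions)**: `Σ_x χ_p(x) conj χ_q(x) = N³ δ_{pq}`. [folklore] -/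
theorem sum_char_mul_star' (p q : Fin N × Fin N × Fin N) :
    ∑ x : Fin N × Fin N × Fin N, χ p x * star (χ q x) = if p = q then (N : ℂ) ^ 3 else 0 := by
  simp_rw [char_symm χ hχ p, char_symm χ hχ q]
  exact sum_char_mul_star χ hχ p q

end Characters

/-! ## §2 Block-circulant (translation-invariant) matrices on `(Fin N)³ × Fin n` -/

section BlockCirculant

variable [NeZero N] {n : ℕ}
variable (χ : (Fin N × Fin N × Fin N) → (Fin N × Fin N × Fin N) → ℂ)
  (hχ : ∀ p x, χ p x = Complex.exp (((∑ i : Fin 3, latticeAngle N p i * ((coordsF x i).val : ℝ) : ℝ) : ℂ) * Complex.I))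
  (M : Matrix ((Fin N × Fin N × Fin N) × Fin n) ((Fin N × Fin N × Fin N) × Fin n) ℂ)
  (hM : ∀ a x y j k, M (x + a, j) (y + a, k) = M (x, j) (y, k))
  (B : (Fin N × Fin N × Fin N) → Matrix (Fin n) (Fin n) ℂ)
  (hB : ∀ p j k, B p j k = ∑ x, M (x, j) (0, k) * star (χ p x))
include hM

/-- Translation invariance read as "the matrix element depends only on the difference": `M (x, j) (y, k) = M (x − y, j) (0, k)`. [folklore] -/
theorem apply_eq_apply_sub_zero (x y : Fin N × Fin N × Fin N) (j k : Fin n) : M (x, j) (y, k) = M (x - y, j) (0, k) := by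
  have h := hM (-y) x y j k
  rw [add_neg_cancel, ← sub_eq_add_neg] at h
  exact h.symm

include hχ hB

/-- **The symbol computes `M` on Bloch waves, one row at a time**: `Σ_y M (x, j) (y, k) χ_p(y) = χ_p(x) · B p j k`. [folklore] -/
theorem sum_apply_mul_char (p x : Fin N × Fin N × Fin N) (j k : Fin n) :
    ∑ y, M (x, j) (y, k) * χ p y = χ p x * B p j k := by
  rw [hB, Finset.mul_sum]
  -- reindex `y = x - d`
  rw [← Equiv.sum_comp (Equiv.subLeft x)]
  refine Finset.sum_congr rfl fun d _ => ?_
  rw [Equiv.subLeft_apply, apply_eq_apply_sub_zero M hM, sub_sub_cancel, char_sub_right χ hχ]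
  ring

/-- **Bloch waves are mapped to Bloch waves**: for `u : Fin n → ℂ` and momentum `p`, the vector `(x, j) ↦ χ_p(x) u_j` is sent by `M` to
`(x, j) ↦ χ_p(x) (B p u)_j` — so eigenvectors of the symbol `B p` give eigenvectors of `M` with the same eigenvalue. [folklore] -/
theorem mulVec_blochWave (p : Fin N × Fin N × Fin N) (u : Fin n → ℂ) :
    M *ᵥ (fun yk => χ p yk.1 * u yk.2) = fun xj => χ p xj.1 * (B p *ᵥ u) xj.2 := by
  funext xj
  obtain ⟨x, j⟩ := xj
  have h1 : (M *ᵥ fun yk => χ p yk.1 * u yk.2) (x, j) =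
      ∑ y : Fin N × Fin N × Fin N, ∑ k : Fin n, M (x, j) (y, k) * (χ p y * u k) := by
    rw [Matrix.mulVec, dotProduct, Fintype.sum_prod_type]
  rw [h1, Finset.sum_comm, Matrix.mulVec, dotProduct, Finset.mul_sum]
  refine Finset.sum_congr rfl fun k _ => ?_
  simp_rw [← mul_assoc]
  rw [← Finset.sum_mul, sum_apply_mul_char χ hχ M hM B hB, mul_assoc]

/-- An eigenvector `u` of the symbol at momentum `p` gives the Bloch-wave eigenvector `χ_p ⊗ u` of `M` with the same eigenvalue. [folklore] -/
theorem mulVec_blochWave_of_eigenvector (p : Fin N × Fin N × Fin N) (u : Fin n → ℂ) (μ : ℂ) (hu : B p *ᵥ u = μ • u) :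
    M *ᵥ (fun yk => χ p yk.1 * u yk.2) = μ • fun yk => χ p yk.1 * u yk.2 := by
  rw [mulVec_blochWave χ hχ M hM B hB, hu]
  funext xj
  simp only [Pi.smul_apply, smul_eq_mul]
  ring

/-- **Hermitian `M` has Hermitian symbols**: `M = Mᴴ ⇒ (B p)ᴴ = B p` for every momentum `p`. [folklore] -/
theorem isHermitian_symbol (hMh : M.IsHermitian) (p : Fin N × Fin N × Fin N) : (B p).IsHermitian := by
  refine Matrix.IsHermitian.ext fun j k => ?_
  rw [hB, hB, star_sum]
  -- `Σ_x conj M(x,k)(0,j) χ_p(x) = Σ_x M(0,j)(x,k) χ_p(x) = Σ_x M(-x,j)(0,k) χ_p(x)`; reindex `x ↦ -x`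
  rw [← Equiv.sum_comp (Equiv.neg (Fin N × Fin N × Fin N))]
  refine Finset.sum_congr rfl fun x _ => ?_
  rw [Equiv.neg_apply, star_mul, star_star, char_neg_right χ hχ]
  have h1 : star (M (-x, k) (0, j)) = M (0, j) (-x, k) := by
    simpa [Matrix.conjTranspose_apply] using congrFun (congrFun hMh.eq (0, j)) (-x, k)
  rw [h1, apply_eq_apply_sub_zero M hM 0 (-x), zero_sub, neg_neg, mul_comm]

variable (F : Matrix ((Fin N × Fin N × Fin N) × Fin n) (Fin n × (Fin N × Fin N × Fin N)) ℂ)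
  (hF : ∀ x j k p, F (x, j) (k, p) = if j = k then χ p x else 0)
include hF

omit [NeZero N] hM hB in
/-- **Orthogonality of the Bloch waves**: `Fᴴ F = N³ · 1`. [folklore] -/
theorem conjTranspose_blochMatrix_mul_self : Fᴴ * F = ((N : ℂ) ^ 3) • (1 : Matrix (Fin n × (Fin N × Fin N × Fin N)) _ ℂ) := by
  ext ⟨k, p⟩ ⟨k', p'⟩
  have h1 : (Fᴴ * F) (k, p) (k', p') =
      ∑ y : Fin N × Fin N × Fin N, ∑ j : Fin n, star (F (y, j) (k, p)) * F (y, j) (k', p') := by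
    rw [Matrix.mul_apply, Fintype.sum_prod_type]
    simp only [Matrix.conjTranspose_apply]
  rw [h1, Matrix.smul_apply, Matrix.one_apply]
  by_cases hk : k = k'
  · subst hk
    have h2 : ∀ y : Fin N × Fin N × Fin N, ∑ j : Fin n, star (F (y, j) (k, p)) * F (y, j) (k, p') = χ p' y * star (χ p y) :=
      fun y => by
        rw [Finset.sum_eq_single k (fun j _ hj => by rw [hF, if_neg hj, star_zero, zero_mul])
          (fun h => (h (Finset.mem_univ k)).elim), hF, hF, if_pos rfl, if_pos rfl, mul_comm]
    simp_rw [h2]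
    rw [sum_char_mul_star' χ hχ p' p]
    by_cases hp : p = p'
    · subst hp
      simp
    · simp [hp, Ne.symm hp]
  · have h2 : ∀ y : Fin N × Fin N × Fin N, ∑ j : Fin n, star (F (y, j) (k, p)) * F (y, j) (k', p') = 0 :=
      fun y => Finset.sum_eq_zero fun j _ => by
        by_cases h : j = k
        · subst h
          rw [hF y j k', if_neg hk, mul_zero]
        · rw [hF y j k, if_neg h, star_zero, zero_mul]
    simp_rw [h2]
    simp [hk]

omit [NeZero N] hM hB in
/-- **Completeness of the Bloch waves**: `F Fᴴ = N³ · 1`. [folklore] -/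
theorem blochMatrix_mul_conjTranspose : F * Fᴴ = ((N : ℂ) ^ 3) • (1 : Matrix ((Fin N × Fin N × Fin N) × Fin n) _ ℂ) := by
  ext ⟨x, j⟩ ⟨y, k⟩
  have h1 : (F * Fᴴ) (x, j) (y, k) =
      ∑ k' : Fin n, ∑ p : Fin N × Fin N × Fin N, F (x, j) (k', p) * star (F (y, k) (k', p)) := by
    rw [Matrix.mul_apply, Fintype.sum_prod_type]
    simp only [Matrix.conjTranspose_apply]
  rw [h1, Matrix.smul_apply, Matrix.one_apply]
  rw [Finset.sum_eq_single j (fun k' _ hk' => Finset.sum_eq_zero fun p _ => by rw [hF x, if_neg (Ne.symm hk'), zero_mul])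
    (fun h => (h (Finset.mem_univ j)).elim)]
  by_cases hjk : j = k
  · subst hjk
    have h2 : ∀ p : Fin N × Fin N × Fin N, F (x, j) (j, p) * star (F (y, j) (j, p)) = χ p x * star (χ p y) := fun p => by
      rw [hF, hF, if_pos rfl, if_pos rfl]
    simp_rw [h2]
    rw [sum_char_mul_star χ hχ x y]
    by_cases hxy : x = y
    · subst hxy
      simp
    · simp [hxy]
  · have h2 : ∀ p : Fin N × Fin N × Fin N, F (x, j) (j, p) * star (F (y, k) (j, p)) = 0 := fun p => by
      rw [hF y, if_neg (Ne.symm hjk), star_zero, mul_zero]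
    simp_rw [h2]
    simp [hjk]

/-- **The intertwining relation** `M F = F · blockDiagonal B` (column `(k, p)` of `F` is the Bloch wave `χ_p ⊗ e_k`). [folklore] -/
theorem mul_blochMatrix : M * F = F * Matrix.blockDiagonal B := by
  ext ⟨x, j⟩ ⟨k, p⟩
  have hl : (M * F) (x, j) (k, p) = ∑ y : Fin N × Fin N × Fin N, M (x, j) (y, k) * χ p y := by
    rw [Matrix.mul_apply, Fintype.sum_prod_type]
    refine Finset.sum_congr rfl fun y _ => ?_
    rw [Finset.sum_eq_single k (fun k' _ hk' => by rw [hF, if_neg hk', mul_zero]) (fun h => (h (Finset.mem_univ k)).elim),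
      hF, if_pos rfl]
  have hr : (F * Matrix.blockDiagonal B) (x, j) (k, p) = χ p x * B p j k := by
    rw [Matrix.mul_apply, Fintype.sum_prod_type]
    rw [Finset.sum_eq_single j (fun k' _ hk' => ?_) (fun h => (h (Finset.mem_univ j)).elim)]
    · rw [Finset.sum_eq_single p (fun p' _ hp' => ?_) (fun h => (h (Finset.mem_univ p)).elim)]
      · rw [hF, if_pos rfl, Matrix.blockDiagonal_apply_eq]
      · rw [Matrix.blockDiagonal_apply_ne _ _ _ hp', mul_zero]
    · exact Finset.sum_eq_zero fun p' _ => by rw [hF, if_neg (Ne.symm hk'), zero_mul]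
  rw [hl, hr, sum_apply_mul_char χ hχ M hM B hB]

/-- Powers intertwine too: `M^t F = F · blockDiagonal (p ↦ (B p)^t)`. [folklore] -/
theorem pow_mul_blochMatrix (t : ℕ) : M ^ t * F = F * Matrix.blockDiagonal (fun p => B p ^ t) := by
  induction t with
  | zero =>
    have h1 : (fun p : Fin N × Fin N × Fin N => B p ^ 0) = 1 := by
      funext p
      rw [pow_zero, Pi.one_apply]
    rw [pow_zero, Matrix.one_mul, h1, Matrix.blockDiagonal_one, Matrix.mul_one]
  | succ t ih =>
    have h1 : (fun p : Fin N × Fin N × Fin N => B p ^ (t + 1)) = fun p => B p ^ t * B p :=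
      funext fun p => pow_succ (B p) t
    rw [h1, Matrix.blockDiagonal_mul, ← Matrix.mul_assoc, ← ih, pow_succ, Matrix.mul_assoc,
      mul_blochMatrix χ hχ M hM B hB F hF, ← Matrix.mul_assoc]

/-- **Block-diagonalisation** `M = N⁻³ · F (blockDiagonal B) Fᴴ`: a translation-invariant matrix on the torus is, in the Bloch-wave frame, the
direct sum over momenta of its symbols. [folklore] -/
theorem eq_blochMatrix_conj : M = ((N : ℂ) ^ 3)⁻¹ • (F * Matrix.blockDiagonal B * Fᴴ) := by
  have hN : ((N : ℂ) ^ 3) ≠ 0 := pow_ne_zero _ (Nat.cast_ne_zero.2 (NeZero.ne N))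
  rw [← mul_blochMatrix χ hχ M hM B hB F hF, Matrix.mul_assoc, blochMatrix_mul_conjTranspose χ hχ F hF, Matrix.mul_smul, Matrix.mul_one,
    smul_smul, inv_mul_cancel₀ hN, one_smul]

/-- Powers: `M^t = N⁻³ · F (blockDiagonal (p ↦ (B p)^t)) Fᴴ`. [folklore] -/
theorem pow_eq_blochMatrix_conj (t : ℕ) : M ^ t = ((N : ℂ) ^ 3)⁻¹ • (F * Matrix.blockDiagonal (fun p => B p ^ t) * Fᴴ) := by
  have hN : ((N : ℂ) ^ 3) ≠ 0 := pow_ne_zero _ (Nat.cast_ne_zero.2 (NeZero.ne N))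
  rw [← pow_mul_blochMatrix χ hχ M hM B hB F hF t, Matrix.mul_assoc, blochMatrix_mul_conjTranspose χ hχ F hF, Matrix.mul_smul,
    Matrix.mul_one, smul_smul, inv_mul_cancel₀ hN, one_smul]

/-- **Trace formula**: `tr M^t = Σ_p tr (B p)^t` — the momentum decomposition behind `Σ_p Re tr B̃(θ_p)^t` in `EffectiveBlochSymbolFamily`.
[folklore] -/
theorem trace_pow_eq_sum_trace_symbol_pow (t : ℕ) : (M ^ t).trace = ∑ p, (B p ^ t).trace := by
  have hN : ((N : ℂ) ^ 3) ≠ 0 := pow_ne_zero _ (Nat.cast_ne_zero.2 (NeZero.ne N))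
  rw [pow_eq_blochMatrix_conj χ hχ M hM B hB F hF t, Matrix.trace_smul, Matrix.mul_assoc, Matrix.trace_mul_comm, Matrix.mul_assoc,
    conjTranspose_blochMatrix_mul_self χ hχ F hF, Matrix.mul_smul, Matrix.mul_one, Matrix.trace_smul, smul_smul, inv_mul_cancel₀ hN,
    one_smul, Matrix.trace_blockDiagonal]

/-- The trace itself: `tr M = Σ_p tr B p`. [folklore] -/
theorem trace_eq_sum_trace_symbol : M.trace = ∑ p, (B p).trace := by
  simpa using trace_pow_eq_sum_trace_symbol_pow χ hχ M hM B hB F hF 1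

end BlockCirculant

end Summit.QuantumFields.YangMills.Theorems.GlueballBandRecursion.Bloch

end
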